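import Mathlib.Data.Real.Basic
import Mathlib.Tactic.Linarith
import Mathlib.Tactic.Positivity
import Mathlib.Tactic.Ring
import Mathlib.Tactic.FieldSimp
import Mathlib.Tactic.LinearCombination
import HarnessLib

/-!
# `NoHeavyLowerTail` (stmt-CriticalPhenomena-4575) — LEMMA Q, part 1: the calculus of `Φ_δ(y) = y/(1−yδ)` and the propagation inequality (proof of APL-P / APL(2/3) for all finite weighted graphs, analytic core)

Support file (prover prim-ineq-gen-8 gen 37; `--supports stmt-CriticalPhenomena-4575`; memo
run/shared/lean/prim/prim-ineq-gen-8/FINDING-gen37-APL-PROOF.md §3).  Pure real algebra: no definitions, no named facts, no sorries.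

SETTING (memo §1–§3).  Along the weight `z ∈ [0,1]` of one apex edge the four isolation probabilities of a (glued) instance `(S; b, c)`,
`U = μ(S|b|c)`, `A = μ(S∤bc)`, `B = μ(b∤Sc)`, `C = μ(c∤Sb)`, are AFFINE, `X(z) = X₀ − z·dX`; the logarithmic derivative of the profile
ratio `R = U⁶/(A²B³C³)` is `ψ = −6φ_U + 2φ_A + 3φ_B + 3φ_C` with `φ_X(z) = dX/X(z) = Φ_z(dX/X₀)`, `Φ_δ(y) := y/(1 − yδ)`.
* `phi_slope`, `phi_jensen2`, `phi_cubic` — slope formula, two-point convexity and the EXACT cubic identity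
  `Φ(3m) − 3Φ(2m) + 3Φ(m) = 6δ²m³/((1−3mδ)(1−2mδ)(1−mδ))` (the third-order tangency of the symmetric hub hierarchy);
* `phi_ineq` — the Φ-INEQUALITY `Φ(3x − (3/2)(p+q)) + (3/2)Φ(p) + (3/2)Φ(q) ≥ 3Φ(x)` for `x ≥ p+q ≥ 0`;
* `phi_semigroup`, `phi_mono`, `phi_shift` — bookkeeping; `psi_propagate` — PROPAGATION: `ψ(z₁) ≥ 0 ⟹ ψ(z) ≥ 0` for `z ≥ z₁`
  (given `φ_U ≥ φ_B + φ_C` at `z₁`);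
* `rowPi_propagate` — ROW Π (`dU·B₀C₀ ≥ U₀(dB·C₀ + dC·B₀)`, a BHK 2006 instance) at `z = 0` implies ROW Π at every `z ∈ [0,1]`
  (exact identity `… = ROW Π(0) + z·dB·dC·(2U₀ − z·dU)`).
Part 2 (`…APLProfileEdgeAnalytic.lean`) turns this into LEMMA Q by the mean value theorem. [this work]
-/

namespace Summit.CriticalPhenomena.PercolationContinuityZ3.Theorems

namespace APL

/-! ### The calculus of `Φ_δ(y) = y / (1 − yδ)` -/

/-- Slope formula: `Φ(y₂) − Φ(y₁) = (y₂ − y₁)/((1−y₁δ)(1−y₂δ))`. [folklore] -/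
theorem phi_slope (δ y₁ y₂ : ℝ) (h₁ : 1 - y₁ * δ ≠ 0) (h₂ : 1 - y₂ * δ ≠ 0) :
    y₂ / (1 - y₂ * δ) - y₁ / (1 - y₁ * δ) = (y₂ - y₁) / ((1 - y₁ * δ) * (1 - y₂ * δ)) := by
  rw [div_sub_div _ _ h₂ h₁, div_eq_div_iff (mul_ne_zero h₂ h₁) (mul_ne_zero h₁ h₂)]
  ring

/-- Two-point convexity of `Φ_δ`: `Φ(p) + Φ(q) − 2Φ((p+q)/2) = δ(p−q)²/(2(1−mδ)(1−pδ)(1−qδ)) ≥ 0`. [folklore] -/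
theorem phi_jensen2 (δ p q : ℝ) (hδ : 0 ≤ δ) (hp : 0 < 1 - p * δ) (hq : 0 < 1 - q * δ) (hm : 0 < 1 - (p + q) / 2 * δ) :
    2 * ((p + q) / 2 / (1 - (p + q) / 2 * δ)) ≤ p / (1 - p * δ) + q / (1 - q * δ) := by
  have key : p / (1 - p * δ) + q / (1 - q * δ) - 2 * ((p + q) / 2 / (1 - (p + q) / 2 * δ))
      = δ * (p - q) ^ 2 / (2 * (1 - (p + q) / 2 * δ) * (1 - p * δ) * (1 - q * δ)) := by
    rw [eq_div_iff (by positivity), div_eq_mul_inv, div_eq_mul_inv, div_eq_mul_inv ((p + q) / 2)]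
    have e1 : (1 - p * δ) * (1 - p * δ)⁻¹ = 1 := mul_inv_cancel₀ hp.ne'
    have e2 : (1 - q * δ) * (1 - q * δ)⁻¹ = 1 := mul_inv_cancel₀ hq.ne'
    have e3 : (1 - (p + q) / 2 * δ) * (1 - (p + q) / 2 * δ)⁻¹ = 1 := mul_inv_cancel₀ hm.ne'
    linear_combination (2 * p * (1 - (p + q) / 2 * δ) * (1 - q * δ)) * e1 + (2 * q * (1 - (p + q) / 2 * δ) * (1 - p * δ)) * e2
      - (2 * (p + q) * (1 - p * δ) * (1 - q * δ)) * e3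
  have hnn : 0 ≤ δ * (p - q) ^ 2 / (2 * (1 - (p + q) / 2 * δ) * (1 - p * δ) * (1 - q * δ)) := by positivity
  linarith

/-- The exact cubic identity `Φ(3m) − 3Φ(2m) + 3Φ(m) = 6δ²m³/((1−3mδ)(1−2mδ)(1−mδ))` (third-order tangency of the symmetric hub
hierarchy). [this work] -/
theorem phi_cubic (δ m : ℝ) (h1 : 1 - m * δ ≠ 0) (h2 : 1 - 2 * m * δ ≠ 0) (h3 : 1 - 3 * m * δ ≠ 0) :
    3 * m / (1 - 3 * m * δ) - 3 * (2 * m / (1 - 2 * m * δ)) + 3 * (m / (1 - m * δ))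
      = 6 * δ ^ 2 * m ^ 3 / ((1 - 3 * m * δ) * (1 - 2 * m * δ) * (1 - m * δ)) := by
  rw [eq_div_iff (mul_ne_zero (mul_ne_zero h3 h2) h1)]
  rw [div_eq_mul_inv, div_eq_mul_inv, div_eq_mul_inv]
  have e1 : (1 - m * δ) * (1 - m * δ)⁻¹ = 1 := mul_inv_cancel₀ h1
  have e2 : (1 - 2 * m * δ) * (1 - 2 * m * δ)⁻¹ = 1 := mul_inv_cancel₀ h2
  have e3 : (1 - 3 * m * δ) * (1 - 3 * m * δ)⁻¹ = 1 := mul_inv_cancel₀ h3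
  linear_combination (3 * m * ((1 - 2 * m * δ) * (1 - m * δ))) * e3 - (6 * m * ((1 - 3 * m * δ) * (1 - m * δ))) * e2
    + (3 * m * ((1 - 3 * m * δ) * (1 - 2 * m * δ))) * e1

/-- **The Φ-inequality.**  For `δ ≥ 0`, `p, q ≥ 0`, `x ≥ p + q` and `T = 3x − (3/2)(p+q)` with `Tδ < 1`:
`Φ(T) + (3/2)Φ(p) + (3/2)Φ(q) ≥ 3Φ(x)`, `Φ(y) = y/(1−yδ)`.  Proof: two-point convexity reduces to `p = q = m`; the value at `x = 2m` is the
cubic identity, and `x ↦ Φ(3x−3m) − 3Φ(x)` is non-decreasing on `x ≥ 2m` by the slope formula. [this work] -/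
theorem phi_ineq (δ p q x : ℝ) (hδ : 0 ≤ δ) (hp : 0 ≤ p) (hq : 0 ≤ q) (hx : p + q ≤ x)
    (hT : (3 * x - 3 / 2 * (p + q)) * δ < 1) :
    3 * (x / (1 - x * δ)) ≤ (3 * x - 3 / 2 * (p + q)) / (1 - (3 * x - 3 / 2 * (p + q)) * δ)
      + 3 / 2 * (p / (1 - p * δ)) + 3 / 2 * (q / (1 - q * δ)) := by
  set m := (p + q) / 2 with hmdef
  set h := x - 2 * m with hhdef
  have hm0 : 0 ≤ m := by rw [hmdef]; positivity
  have hh0 : 0 ≤ h := by rw [hhdef, hmdef]; linarith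
  have hTeq : 3 * x - 3 / 2 * (p + q) = 3 * m + 3 * h := by rw [hhdef, hmdef]; ring
  have hxeq : x = 2 * m + h := by rw [hhdef]; ring
  -- positivity of all denominators (the largest argument is `T = 3m + 3h`)
  have dT : 0 < 1 - (3 * m + 3 * h) * δ := by rw [← hTeq]; linarith
  have d3m : 0 < 1 - 3 * m * δ := by nlinarith [mul_nonneg hh0 hδ]
  have d2mh : 0 < 1 - (2 * m + h) * δ := by nlinarith [mul_nonneg hh0 hδ, mul_nonneg hm0 hδ]
  have d2m : 0 < 1 - 2 * m * δ := by nlinarith [mul_nonneg hm0 hδ]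
  have dm : 0 < 1 - m * δ := by nlinarith [mul_nonneg hm0 hδ]
  have dp : 0 < 1 - p * δ := by
    have : p ≤ 2 * m := by rw [hmdef]; linarith
    nlinarith [mul_nonneg hq hδ]
  have dq : 0 < 1 - q * δ := by
    have : q ≤ 2 * m := by rw [hmdef]; linarith
    nlinarith [mul_nonneg hp hδ]
  -- (a) two-point convexity
  have ha := phi_jensen2 δ p q hδ dp dq (by rw [← hmdef]; exact dm)
  rw [← hmdef] at ha
  -- (b) the cubic identity at `x = 2m`
  have hb : 0 ≤ 3 * m / (1 - 3 * m * δ) - 3 * (2 * m / (1 - 2 * m * δ)) + 3 * (m / (1 - m * δ)) := by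
    rw [phi_cubic δ m dm.ne' d2m.ne' d3m.ne']
    positivity
  -- (c) monotonicity in `x`: `[Φ(3m+3h) − Φ(3m)] ≥ 3[Φ(2m+h) − Φ(2m)]`
  have hc : 3 * ((2 * m + h) / (1 - (2 * m + h) * δ) - 2 * m / (1 - 2 * m * δ))
      ≤ (3 * m + 3 * h) / (1 - (3 * m + 3 * h) * δ) - 3 * m / (1 - 3 * m * δ) := by
    rw [phi_slope δ (2 * m) (2 * m + h) d2m.ne' d2mh.ne', phi_slope δ (3 * m) (3 * m + 3 * h) d3m.ne' dT.ne']
    have e1 : 2 * m + h - 2 * m = h := by ring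
    have e2 : 3 * m + 3 * h - 3 * m = 3 * h := by ring
    rw [e1, e2]
    -- 3h/((1-2mδ)(1-(2m+h)δ)) ≤ 3h/((1-3mδ)(1-(3m+3h)δ))
    have hD : (1 - 3 * m * δ) * (1 - (3 * m + 3 * h) * δ) ≤ (1 - 2 * m * δ) * (1 - (2 * m + h) * δ) := by
      apply mul_le_mul _ _ dT.le d2m.le
      · nlinarith [mul_nonneg hm0 hδ]
      · nlinarith [mul_nonneg hm0 hδ, mul_nonneg hh0 hδ]
    have hD1 : 0 < (1 - 3 * m * δ) * (1 - (3 * m + 3 * h) * δ) := mul_pos d3m dT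
    rw [show 3 * (h / ((1 - 2 * m * δ) * (1 - (2 * m + h) * δ))) = 3 * h / ((1 - 2 * m * δ) * (1 - (2 * m + h) * δ)) by ring]
    exact div_le_div_of_nonneg_left (by positivity) hD1 hD
  -- assemble
  rw [hTeq, hxeq]
  have split : (3 * m + 3 * h) / (1 - (3 * m + 3 * h) * δ) + 3 / 2 * (p / (1 - p * δ)) + 3 / 2 * (q / (1 - q * δ))
      - 3 * ((2 * m + h) / (1 - (2 * m + h) * δ))
      = ((3 * m + 3 * h) / (1 - (3 * m + 3 * h) * δ) - 3 * m / (1 - 3 * m * δ)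
          - 3 * ((2 * m + h) / (1 - (2 * m + h) * δ) - 2 * m / (1 - 2 * m * δ)))
        + (3 * m / (1 - 3 * m * δ) - 3 * (2 * m / (1 - 2 * m * δ)) + 3 * (m / (1 - m * δ)))
        + 3 / 2 * (p / (1 - p * δ) + q / (1 - q * δ) - 2 * (m / (1 - m * δ))) := by ring
  linarith [split, ha, hb, hc]

/-- Semigroup of `Φ`: `y/(1 − yz) = Φ_{z−z₁}(y/(1 − yz₁))`. [folklore] -/
theorem phi_semigroup (y z₁ z : ℝ) (h₁ : 1 - y * z₁ ≠ 0) :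
    y / (1 - y * z) = (y / (1 - y * z₁)) / (1 - (y / (1 - y * z₁)) * (z - z₁)) := by
  have h' : 1 - (y / (1 - y * z₁)) * (z - z₁) = (1 - y * z) / (1 - y * z₁) := by
    rw [eq_div_iff h₁, sub_mul, one_mul, mul_assoc, mul_comm (z - z₁), ← mul_assoc, div_mul_cancel₀ _ h₁]
    ring
  rw [h', div_div_div_cancel_right₀ h₁]

/-- Monotonicity of `Φ_z` on its domain. [folklore] -/
theorem phi_mono (z y₁ y₂ : ℝ) (hz : 0 ≤ z) (hy : y₁ ≤ y₂) (h₂ : 0 < 1 - y₂ * z) :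
    y₁ / (1 - y₁ * z) ≤ y₂ / (1 - y₂ * z) := by
  have h₁ : 0 < 1 - y₁ * z := by nlinarith
  rw [div_le_div_iff₀ h₁ h₂]
  nlinarith

/-- **Propagation.**  With `x = Φ_{z₁}(π₀)`, `a = Φ_{z₁}(π_A)`, `p = Φ_{z₁}(π_B)`, `q = Φ_{z₁}(π_C)` already evaluated at `z₁`:
if `x ≥ p + q ≥ 0` and `ψ(z₁) = −6x + 2a + 3p + 3q ≥ 0`, then for every `δ ≥ 0` with `aδ < 1`,
`−6Φ_δ(x) + 2Φ_δ(a) + 3Φ_δ(p) + 3Φ_δ(q) ≥ 0`. [this work] -/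
theorem psi_propagate (δ x a p q : ℝ) (hδ : 0 ≤ δ) (hp : 0 ≤ p) (hq : 0 ≤ q) (hx : p + q ≤ x)
    (hψ : 0 ≤ -6 * x + 2 * a + 3 * p + 3 * q) (ha : a * δ < 1) :
    0 ≤ -6 * (x / (1 - x * δ)) + 2 * (a / (1 - a * δ)) + 3 * (p / (1 - p * δ)) + 3 * (q / (1 - q * δ)) := by
  have hTa : 3 * x - 3 / 2 * (p + q) ≤ a := by linarith
  have hT : (3 * x - 3 / 2 * (p + q)) * δ < 1 := lt_of_le_of_lt (mul_le_mul_of_nonneg_right hTa hδ) ha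
  have h1 := phi_ineq δ p q x hδ hp hq hx hT
  have h2 : (3 * x - 3 / 2 * (p + q)) / (1 - (3 * x - 3 / 2 * (p + q)) * δ) ≤ a / (1 - a * δ) :=
    phi_mono δ _ _ hδ hTa (by linarith)
  linarith

/-- Shift of the base point: `Φ_δ(d/X) = d/(X − δd)`. [folklore] -/
theorem phi_shift (d X δ : ℝ) (hX : X ≠ 0) : (d / X) / (1 - (d / X) * δ) = d / (X - δ * d) := by
  have e : 1 - (d / X) * δ = (X - δ * d) / X := by
    rw [eq_div_iff hX, sub_mul, one_mul, mul_comm (d / X) δ, mul_assoc, div_mul_cancel₀ _ hX]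
  rw [e, div_div_div_cancel_right₀ hX]

/-! ### ROW Π propagates along the edge -/

/-- ROW Π at `z = 0` implies ROW Π at every `z ∈ [0,1]`: with `X(z) = X₀ − z·dX`,
`dU·B(z)C(z) − U(z)(dB·C(z) + dC·B(z)) = [dU·B₀C₀ − U₀(dB·C₀ + dC·B₀)] + z·dB·dC·(2U₀ − z·dU)`. [this work] -/
theorem rowPi_propagate (U0 dU B0 dB C0 dC z : ℝ) (hz0 : 0 ≤ z) (hz1 : z ≤ 1) (hU0 : 0 ≤ U0) (hdU : dU ≤ U0)
    (hdB : 0 ≤ dB) (hdC : 0 ≤ dC) (hPi : U0 * (dB * C0 + dC * B0) ≤ dU * B0 * C0) :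
    (U0 - z * dU) * (dB * (C0 - z * dC) + dC * (B0 - z * dB)) ≤ dU * (B0 - z * dB) * (C0 - z * dC) := by
  have key : dU * (B0 - z * dB) * (C0 - z * dC) - (U0 - z * dU) * (dB * (C0 - z * dC) + dC * (B0 - z * dB))
      = (dU * B0 * C0 - U0 * (dB * C0 + dC * B0)) + z * dB * dC * (2 * U0 - z * dU) := by ring
  have h2 : 0 ≤ 2 * U0 - z * dU := by nlinarith
  have h3 : 0 ≤ z * dB * dC * (2 * U0 - z * dU) := by positivity
  linarith


end APL

end Summit.CriticalPhenomena.PercolationContinuityZ3.Theorems
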